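import Summits.HubbardSuperconductivity.HubbardLadder.Bounds.ThermalMottCDWCeilingGlue
import HarnessLib


/-!
# Hubbard ladder — Bounds: the GRAND-CANONICAL thermal Mott-window kinetic ceiling and the
# staggered charge (CDW) ceiling of the half-filled repulsive torus at `T > 0`
# (bounds.tex Cor. 11.1(i)–(ii), typed AND proved modulo the cited Kubo–Kishi Gaussian domination)

HONEST FRAMING (cell pub-hubbard): ladder R1–R4 with certified numbers; no claim on H/H₀. These
are bounds for a MODEL CLASS — the repulsive Hubbard torus `hamiltonianWith (fermionTorusGraph 2 L)
1 U (U/2)` (`= hubbardTorusWith 2 L 1 U (U/2)` by `rfl`; `t = 1`, `U > 0`, chemical potential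
`μ = U/2`, torus `(ℤ/Lℤ)²`, `L ≥ 4` even) in its GRAND-CANONICAL Gibbs state `⟨·⟩_β` on the full
Fock space at `β > 0`; no materials claim. Companion text: `pub-hubbard/paper/bounds.tex` Cor. 11.1;
tables `pub-hubbard/pub-hubbard-bounds/BOUNDS.md` (rows T5♯_T, T9) and `EXTREMISERS.md` §5o.

Part B of two (tree 400-line cap): the generic grand-canonical glue (`groundEnergy_le_re_gibbsState`,
`groundEnergy_hamiltonianWith_le`, `le_groundEnergy_hamiltonianWith`, `hoppingForm_congr_adj`,
`hoppingForm_const`) lives in `ThermalMottCDWCeilingGlue.lean` (LEAN FILING REQUEST #163 part 1, p243049), imported here; it is listed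
below for the reader.

## What is proved (no `sorry`, no new axioms)

Generic grand-canonical glue (every finite graph `G`, all real `t, U, μ`):
* `groundEnergy_le_re_gibbsState` — `E₀(A) ≤ Re⟨A⟩_{β,H}` for Hermitian `A`, `H` (Gibbs positivity
  on `A - E₀(A) ≥ 0`).
* `groundEnergy_hamiltonianWith_le` — `E₀(H(t,U) - μN) ≤ E_G(t,U;N) - μN` for every `N ≤ 2|Λ|`
  (the `N`-particle ground state as a trial state).
* `le_groundEnergy_hamiltonianWith` — conversely, a bound `c ≤ E_G(t,U;N) - μN` valid for EVERY
  `N ≤ 2|Λ|` gives `c ≤ E₀(H(t,U) - μN)` (a ground vector of `H - μN` has a non-zero component in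
  some `(N↑, N↓)` sector, itself a ground vector, since `H - μN` preserves the sectors).

The torus theorems (`L ≥ 4` even — `Even L`, `3 ≤ L` —, `0 ≤ U₁ < U`, `Δ ≠ 0`, `β > 0`;
`lmClosed`, `sdwClosed` the closed-form Langer–Mattis / SDW brackets of `MottStiffnessCeiling`):
* `re_gibbsState_hoppingForm_le_mott_gc` — **Cor. 11.1(i), grand-canonical thermal Mott kinetic
  ceiling with ONE entropy term**: `k := Re⟨T(1)⟩_β = |Λ| 𝒦_β` (`T(1) = Σ_{x∼y,σ} c†_{xσ}c_{yσ}
  = hoppingForm G 1`, so that the hopping term of `H` is `-t T(1)`) obeys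
  `k ≤ L² (U₁ sdwClosed U Δ - U lmClosed U₁)/(U - U₁) + (U₁/(U - U₁)) L² (log 4)/β`.
  Proof: the energy chord. With `x := Re⟨D⟩_β - Re⟨N⟩_β/2` one has
  `Re⟨H(1,U') - (U'/2)N⟩_β = -k + U' x` for `U' = U, U₁` (same state); the upper bracket
  `Re⟨H_U⟩_β ≤ E₀(H_U) + (log dim)/β ≤ E_L(U;L²) - (U/2)L² + L² (log 4)/β ≤ L² sdwClosed - (U/2)L² + …`
  (`re_gibbsState_self_le_groundEnergy_add`, `groundEnergy_hamiltonianWith_le`, `dim = 4^{L²}`);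
  the lower bracket `Re⟨H_{U₁}⟩_β ≥ E₀(H_{U₁}) ≥ L² lmClosed U₁ - (U₁/2) L²`
  (`groundEnergy_le_re_gibbsState`, `le_groundEnergy_hamiltonianWith` and the ALL-`N` Langer–Mattis
  floor `hubbardTorus_groundEnergyAt_ge_lmClosed`, whose `(U₁/2)N` term is exactly the chemical
  potential at half filling); then `kin_le_of_mott_brackets_arith` — the `μ`-terms cancel in
  `U₁ R - U L₁`. The constant is the canonical one of `ThermalMottKineticCeilingSharp` with
  `log N_p ↦ L² log 4`.
* `re_gibbsState_staggeredCharge_sq_le_mott_gc` — **Cor. 11.1(ii), the thermal Mott CDW ceiling**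
  (conditional on the cited Kubo–Kishi Gaussian domination `kuboKishi_charge_gaussianDomination`,
  KK90 Thm 2): for the staggered charge field `F_Q = Σ_x (-1)^x (n_x - 1)`,
  `⟨F_Q²⟩_β ≤ L²/(βU) + ½ √((L²/U) · 4 k_max)`, `k_max` the right side of Cor. 11.1(i); per site
  `S^{cc}(Q) := ⟨F_Q²⟩_β/L² ≤ T/U + √(κ̃/U)`, `κ̃ = (U₁ sdwClosed U Δ - U lmClosed U₁)/(U - U₁) +
  (U₁/(U - U₁)) T log 4`. Proof: Kubo–Kishi's Falk–Bruch form `kuboKishi_charge_falkBruch_le_torus` +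
  the exact f-sum identity `chargeDensityField_doubleComm_eq` (`[F_a,[H,F_a]] = t T((a_x - a_y)²)`,
  here `(a_x - a_y)² = 4` on every bond, i.e. `4 T(1)`) + part (i). (The full-Fock-space glue lemmas
  take the caller's `DecidableEq` instance on configurations, so that they apply verbatim on the torus.)
* Nodes `ThermalMottKineticCeilingGC`, `ThermalMottCDWCeilingKK` (`@[conjecture] def`, proved by
  `…_holds`), and the instance `ThermalMottCDWCeilingU20KK` (`U = 20`, `U₁ = Δ = 10`):
  `S^{cc}(Q) ≤ T/20 + √((1.228 + T log 4)/20)` (`= 0.248` at `T → 0`; the graph-degree form of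
  KK90 Remark 3 / `kuboKishi_staggered_charge_sq_le` gives `√(4/20) = 0.447` there).

Honest numbers: informative only in the Mott window `U ≳ 14 t`, `T ≲ t`; the CDW statement is
CONDITIONAL on the published Gaussian-domination inequality of Kubo–Kishi (a named Literature fact
used as a hypothesis, never an axiom); the kinetic statement (i) is unconditional.
References (keys of `lean/references.bib`): KuboKishi1990 Thm 2, Remark 3; LangerMattis1971
eqs. (3)–(5); DysonLiebSimon1978 Thm 3.1; HazraVermaRanderia2019 §III; EsslerEtAl2005 eq. (2.72).
-/


noncomputable section

namespace Summit.HubbardSuperconductivity.HubbardLadder.Bounds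

open Matrix Finset Real
open Literature.MathematicalPhysics.QuantumLattice
open Literature.MathematicalPhysics.QuantumFieldTheory
open Literature.Probability.LatticeModels
open scoped ComplexOrder ComplexConjugate

/-! ### The torus: Cor. 11.1(i), the grand-canonical thermal Mott kinetic ceiling -/

section Torus

variable {L : ℕ} [NeZero L]

/-- The torus graph `(ℤ/Lℤ)²` with nearest-neighbour bonds. -/
local notation "Gᴸ" => fermionTorusGraph 2 L
/-- `H(1,U') - (U'/2)N` on the torus (`= hubbardTorusWith 2 L 1 U' (U'/2)`). -/
local notation "H[" U' "]" => hamiltonianWith (fermionTorusGraph 2 L) 1 U' (U' / 2)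
/-- `T(1) = Σ_{x∼y,σ} c†_{xσ} c_{yσ}` on the torus. -/
local notation "T₁" => hoppingForm (fermionTorusGraph 2 L) fun _ _ => (1 : ℝ)
/-- The staggered charge field `F_Q = Σ_x (-1)^x (n_x - 1)`. -/
local notation "F_Q" =>
  chargeDensityField fun x => ((torusStagger (d := 2) (L := L) x : ℤ) : ℝ)

omit [NeZero L] in
/-- `dim` of the full Fock space of the `L × L` torus: `|Finset (Orb Λ)| = 2^{2L²}`, so
`log dim = L² log 4`. -/
theorem log_card_fock_fermionTorus_two :
    Real.log (Fintype.card (Finset (Orb (FermionTorus 2 L)))) = (L : ℝ) ^ 2 * Real.log 4 := by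
  rw [Fintype.card_finset, card_orb, show Fintype.card (FermionTorus 2 L) = L ^ 2 by
    simp [FermionTorus]]
  push_cast
  rw [Real.log_pow, show (4 : ℝ) = 2 ^ 2 by norm_num, Real.log_pow]
  push_cast
  ring

/-- **Cor. 11.1(i): the grand-canonical thermal Mott-window kinetic ceiling, ONE entropy term**
(`L ≥ 4` even, `0 ≤ U₁ < U`, `Δ ≠ 0`, `β > 0`; Gibbs state of `H = H(1,U) - (U/2)N` on the full Fock
space of the torus): `Re⟨T(1)⟩_β ≤ L² (U₁ sdwClosed U Δ - U lmClosed U₁)/(U - U₁) +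
(U₁/(U - U₁)) L² (log 4)/β`. -/
theorem re_gibbsState_hoppingForm_le_mott_gc (hLe : Even L) (hL : 3 ≤ L) {U U₁ Δ β : ℝ}
    (hU₁ : 0 ≤ U₁) (hU : U₁ < U) (hΔ : Δ ≠ 0) (hβ : 0 < β) :
    (gibbsState β (hamiltonianWith (fermionTorusGraph 2 L) 1 U (U / 2))
        (hoppingForm (fermionTorusGraph 2 L) fun _ _ => 1)).re ≤
      (L : ℝ) ^ 2 * ((U₁ * sdwClosed U Δ - U * lmClosed U₁) / (U - U₁)) +
        U₁ / (U - U₁) * ((L : ℝ) ^ 2 * Real.log 4 / β) := by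
  have hU0 : 0 ≤ U := hU₁.trans hU.le
  have hcard : Fintype.card (FermionTorus 2 L) = L ^ 2 := by simp [FermionTorus]
  have hHh : (H[U]).IsHermitian := isHermitian_hamiltonianWith Gᴸ 1 U (U / 2)
  have hH₁h : (H[U₁]).IsHermitian := isHermitian_hamiltonianWith Gᴸ 1 U₁ (U₁ / 2)
  -- the decomposition `H(1,U') - (U'/2)N = -T(1) + (U' D - (U'/2) N)`
  have hdec : ∀ U' : ℝ, H[U'] =
      -T₁ + (((U' : ℝ) : ℂ) • (∑ x : FermionTorus 2 L, numberOp x 0 * numberOp x 1) -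
        (((U' / 2 : ℝ)) : ℂ) •
          (totalNumber : Matrix (Finset (Orb (FermionTorus 2 L))) (Finset (Orb (FermionTorus 2 L))) ℂ)) := by
    intro U'
    rw [hamiltonianWith_eq_hoppingForm, densityTerms_eq, neg_smul, Complex.ofReal_one, one_smul]
  -- the three Gibbs quantities
  set k : ℝ := (gibbsState β (H[U]) T₁).re with hk
  set dD : ℝ := (gibbsState β (H[U])
    (∑ x : FermionTorus 2 L, numberOp x 0 * numberOp x 1)).re with hdD
  set nN : ℝ := (gibbsState β (H[U])
    (totalNumber : Matrix (Finset (Orb (FermionTorus 2 L))) (Finset (Orb (FermionTorus 2 L))) ℂ)).re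
    with hnN
  have hval : ∀ U' : ℝ, (gibbsState β (H[U]) (H[U'])).re = -k + U' * (dD - nN / 2) := by
    intro U'
    rw [hdec U', map_add, map_neg, map_sub, map_smul, map_smul, Complex.add_re, Complex.neg_re,
      Complex.sub_re, smul_eq_mul, smul_eq_mul, Complex.re_ofReal_mul, Complex.re_ofReal_mul,
      ← hk, ← hdD, ← hnN]
    ring
  -- (1) upper bracket at `U`
  have hup : -k + U * (dD - nN / 2) ≤
      ((L : ℝ) ^ 2 * sdwClosed U Δ - U / 2 * (L : ℝ) ^ 2) + (L : ℝ) ^ 2 * Real.log 4 / β := by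
    have h1 := re_gibbsState_self_le_groundEnergy_add hHh hβ
    rw [log_card_fock_fermionTorus_two, hval U] at h1
    have h2 : (H[U]).groundEnergy ≤ groundEnergyAt Gᴸ 1 U (L ^ 2) - U / 2 * ((L ^ 2 : ℕ) : ℝ) :=
      groundEnergy_hamiltonianWith_le Gᴸ 1 U (U / 2) (N := L ^ 2) (by rw [hcard]; omega)
    have h3 : groundEnergyAt Gᴸ 1 U (L ^ 2) ≤ (L : ℝ) ^ 2 * sdwClosed U Δ :=
      hubbardTorus_groundEnergyAt_le_sdwClosed hLe hL hU0 hΔ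
    push_cast at h2
    linarith
  -- (2) lower bracket at `U₁`: the all-`N` Langer–Mattis floor, read in the Gibbs state of `H`
  have hlow : ((L : ℝ) ^ 2 * lmClosed U₁ - U₁ / 2 * (L : ℝ) ^ 2) ≤ -k + U₁ * (dD - nN / 2) := by
    have h1 : (L : ℝ) ^ 2 * lmClosed U₁ - U₁ / 2 * (L : ℝ) ^ 2 ≤ (H[U₁]).groundEnergy := by
      refine le_groundEnergy_hamiltonianWith Gᴸ 1 U₁ (U₁ / 2) _ fun N hN => ?_
      rw [hcard] at hN
      have h := hubbardTorus_groundEnergyAt_ge_lmClosed hLe hL U₁ hN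
      rw [lmClosed]
      linarith
    have h2 : (H[U₁]).groundEnergy ≤ (gibbsState β (H[U]) (H[U₁])).re :=
      groundEnergy_le_re_gibbsState hHh hH₁h β
    rw [hval U₁] at h2
    linarith
  have h := kin_le_of_mott_brackets_arith hU₁ hU hlow hup
  have e : (U₁ * ((L : ℝ) ^ 2 * sdwClosed U Δ - U / 2 * (L : ℝ) ^ 2) -
      U * ((L : ℝ) ^ 2 * lmClosed U₁ - U₁ / 2 * (L : ℝ) ^ 2)) / (U - U₁) =
      (L : ℝ) ^ 2 * ((U₁ * sdwClosed U Δ - U * lmClosed U₁) / (U - U₁)) := by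
    have hd : U - U₁ ≠ 0 := (sub_pos.2 hU).ne'
    field_simp
    ring
  rw [e] at h
  exact h

/-- Node form of Cor. 11.1(i) (`H = hubbardTorusWith 2 L 1 U (U/2)` definitionally). Per site:
`𝒦_β ≤ κ̃(U, U₁, Δ, T) := (U₁ sdwClosed U Δ - U lmClosed U₁)/(U - U₁) + (U₁/(U - U₁)) T log 4`; at
`U₁ = Δ = U/2` this is `κ(U) + T log 4`, `κ(U) = 4[(√(256+U²) - U)/16 + U/(16+U²) - 2/√(64+U²)]`
(`κ(20) = 1.2241`). kind: support (PROVED). Why it might fail: it cannot; informative only for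
`U ≳ 14 t`, `T ≲ t`. Sources: LangerMattis1971 eqs. (3)–(5); HazraVermaRanderia2019 §III; this cell
(bounds.tex Thm 7♯, Cor. 11.1(i); canonical twin `ThermalMottKineticCeilingSharp`). -/
@[conjecture] def ThermalMottKineticCeilingGC : Prop :=
  ∀ (L : ℕ) [NeZero L], Even L → 3 ≤ L → ∀ (U U₁ Δ β : ℝ), 0 ≤ U₁ → U₁ < U → Δ ≠ 0 → 0 < β →
    (gibbsState β (hamiltonianWith (fermionTorusGraph 2 L) 1 U (U / 2))
        (hoppingForm (fermionTorusGraph 2 L) fun _ _ => 1)).re ≤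
      (L : ℝ) ^ 2 * ((U₁ * sdwClosed U Δ - U * lmClosed U₁) / (U - U₁)) +
        U₁ / (U - U₁) * ((L : ℝ) ^ 2 * Real.log 4 / β)

omit [NeZero L] in
/-- **`ThermalMottKineticCeilingGC` holds.** -/
theorem thermalMottKineticCeilingGC_holds : ThermalMottKineticCeilingGC := by
  intro L _ hLe hL U U₁ Δ β hU₁ hU hΔ hβ
  exact re_gibbsState_hoppingForm_le_mott_gc hLe hL hU₁ hU hΔ hβ

/-! ### Cor. 11.1(ii): the thermal Mott CDW ceiling (modulo Kubo–Kishi's Gaussian domination) -/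

omit [NeZero L] in
/-- Monotonicity of the Falk–Bruch right side in the double-commutator slot. -/
theorem fb_rhs_mono' {b β c c' : ℝ} (hb : 0 ≤ b) (hc : c ≤ c') :
    b / β + 1 / 2 * Real.sqrt (b * c) ≤ b / β + 1 / 2 * Real.sqrt (b * c') := by
  have : Real.sqrt (b * c) ≤ Real.sqrt (b * c') :=
    Real.sqrt_le_sqrt (mul_le_mul_of_nonneg_left hc hb)
  linarith

/-- **Cor. 11.1(ii): the staggered charge structure factor of the half-filled repulsive torus in the
Mott window** (`L ≥ 4` even, `0 ≤ U₁ < U`, `Δ ≠ 0`, `β > 0`; conditional on Kubo–Kishi's Gaussian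
domination, KK90 Thm 2): with `F_Q = Σ_x (-1)^x (n_x - 1)` and `k_max` the right side of
Cor. 11.1(i), `⟨F_Q²⟩_β ≤ L²/(βU) + ½ √((L²/U) · 4 k_max)`, i.e. per site
`S^{cc}(Q) ≤ T/U + √(κ̃/U)`. [KuboKishi1990 Thm 2 + Remark 3, with the degree bound `2d|t|` of the
double commutator replaced by the Mott-window kinetic ceiling through the exact f-sum identity.] -/
theorem re_gibbsState_staggeredCharge_sq_le_mott_gc (hKK : kuboKishi_charge_gaussianDomination)
    (hLe : Even L) (hL : 3 ≤ L) {U U₁ Δ β : ℝ} (hU₁ : 0 ≤ U₁) (hU : U₁ < U) (hΔ : Δ ≠ 0)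
    (hβ : 0 < β) :
    (gibbsState β (hamiltonianWith (fermionTorusGraph 2 L) 1 U (U / 2))
        (chargeDensityField (fun x => ((torusStagger (d := 2) (L := L) x : ℤ) : ℝ)) *
          chargeDensityField fun x => ((torusStagger (d := 2) (L := L) x : ℤ) : ℝ))).re ≤
      (L : ℝ) ^ 2 / U / β +
        1 / 2 * Real.sqrt ((L : ℝ) ^ 2 / U *
          (4 * ((L : ℝ) ^ 2 * ((U₁ * sdwClosed U Δ - U * lmClosed U₁) / (U - U₁)) +
            U₁ / (U - U₁) * ((L : ℝ) ^ 2 * Real.log 4 / β)))) := by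
  have hU0 : 0 < U := lt_of_le_of_lt hU₁ hU
  have hcard : Fintype.card (FermionTorus 2 L) = L ^ 2 := by simp [FermionTorus]
  have hε : ∀ x y : FermionTorus 2 L, (Gᴸ).Adj x y →
      torusStagger (d := 2) (L := L) x = -torusStagger y :=
    fun _ _ h => torusStagger_eq_neg_of_adj_holds hLe h
  -- Kubo–Kishi's Falk–Bruch form on the torus (its statement carries the torus's own instances),
  -- one field, rewritten over `hamiltonianWith` (`hubbardTorusWith = hamiltonianWith ∘ torus`, rfl)
  have h := kuboKishi_charge_falkBruch_le_torus (d := 2) (L := L) hKK hLe (t := 1) hU0 hβ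
    (ι := Unit) (fun _ => fun x => ((torusStagger (d := 2) (L := L) x : ℤ) : ℝ))
  simp only [Finset.univ_unique, Finset.sum_singleton] at h
  rw [show hubbardTorusWith 2 L 1 U (U / 2) = H[U] from rfl] at h
  have hsq : ∀ x : FermionTorus 2 L, (((torusStagger (d := 2) (L := L) x : ℤ) : ℝ)) ^ 2 = 1 := by
    intro x
    rcases Int.units_eq_one_or (torusStagger (d := 2) (L := L) x) with h1 | h1 <;> simp [h1]
  have hB : (∑ x : FermionTorus 2 L, (((torusStagger (d := 2) (L := L) x : ℤ) : ℝ)) ^ 2) =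
      (L : ℝ) ^ 2 := by
    simp [hsq, hcard]
  rw [hB] at h
  -- the exact f-sum identity: the double commutator is `4 T(1)` (every bond has `(a_x - a_y)² = 4`)
  have hgrad : ∀ x y : FermionTorus 2 L, (Gᴸ).Adj x y →
      (((torusStagger (d := 2) (L := L) x : ℤ) : ℝ) - ((torusStagger (d := 2) (L := L) y : ℤ) : ℝ)) ^ 2
        = 4 := by
    intro x y hxy
    have e : ((torusStagger (d := 2) (L := L) y : ℤ) : ℝ) = -((torusStagger (d := 2) (L := L) x : ℤ) : ℝ) := by
      rw [hε x y hxy, Units.val_neg, Int.cast_neg, neg_neg]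
    rw [e, show ∀ r : ℝ, (r - -r) ^ 2 = 4 * r ^ 2 from fun r => by ring, hsq x, mul_one]
  have hdc : F_Q * (H[U] * F_Q - F_Q * H[U]) - (H[U] * F_Q - F_Q * H[U]) * F_Q = ((4 : ℝ) : ℂ) • T₁ := by
    rw [chargeDensityField_doubleComm_eq Gᴸ _ 1 U (U / 2), hoppingForm_congr_adj Gᴸ hgrad,
      hoppingForm_const Gᴸ 4, smul_smul, Complex.ofReal_one, one_mul]
  have hre : (gibbsState β (H[U]) (F_Q * (H[U] * F_Q - F_Q * H[U]) - (H[U] * F_Q - F_Q * H[U]) * F_Q)).re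
      = 4 * (gibbsState β (H[U]) T₁).re := by
    rw [hdc, map_smul, smul_eq_mul, Complex.re_ofReal_mul]
  rw [hre] at h
  refine h.trans (fb_rhs_mono' (div_nonneg (sq_nonneg _) hU0.le) ?_)
  exact mul_le_mul_of_nonneg_left (re_gibbsState_hoppingForm_le_mott_gc hLe hL hU₁ hU hΔ hβ)
    (by norm_num)

/-- Node form of Cor. 11.1(ii) (conditional on the cited Kubo–Kishi Gaussian domination). Per site:
`S^{cc}(Q) := ⟨F_Q²⟩_β/L² ≤ T/U + √(κ̃/U)`. kind: support (PROVED, modulo the named Literature fact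
`kuboKishi_charge_gaussianDomination`). Why it might fail: the Lean statement cannot; the cited
Gaussian domination is KK90 Thm 2 (reflection-free, every bipartite graph). Sources: KuboKishi1990
Thm 2, Remark 3; DysonLiebSimon1978 Thm 3.1; this cell (bounds.tex Thm 11, Cor. 11.1(ii)). -/
@[conjecture] def ThermalMottCDWCeilingKK : Prop :=
  kuboKishi_charge_gaussianDomination →
  ∀ (L : ℕ) [NeZero L], Even L → 3 ≤ L → ∀ (U U₁ Δ β : ℝ), 0 ≤ U₁ → U₁ < U → Δ ≠ 0 → 0 < β →
    (gibbsState β (hamiltonianWith (fermionTorusGraph 2 L) 1 U (U / 2))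
        (chargeDensityField (fun x => ((torusStagger (d := 2) (L := L) x : ℤ) : ℝ)) *
          chargeDensityField fun x => ((torusStagger (d := 2) (L := L) x : ℤ) : ℝ))).re ≤
      (L : ℝ) ^ 2 / U / β +
        1 / 2 * Real.sqrt ((L : ℝ) ^ 2 / U *
          (4 * ((L : ℝ) ^ 2 * ((U₁ * sdwClosed U Δ - U * lmClosed U₁) / (U - U₁)) +
            U₁ / (U - U₁) * ((L : ℝ) ^ 2 * Real.log 4 / β))))

omit [NeZero L] in
/-- **`ThermalMottCDWCeilingKK` holds.** -/
theorem thermalMottCDWCeilingKK_holds : ThermalMottCDWCeilingKK := by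
  intro hKK L _ hLe hL U U₁ Δ β hU₁ hU hΔ hβ
  exact re_gibbsState_staggeredCharge_sq_le_mott_gc hKK hLe hL hU₁ hU hΔ hβ

/-! ### The instance `U = 20 t` (`U₁ = Δ = 10`) -/

/-- **`U = 20 t`: `S^{cc}(Q) ≤ T/20 + √((1.228 + T log 4)/20)`** per site for the grand-canonical
half-filled torus, every even `L ≥ 4`, every `T = 1/β > 0` (conditional on KK90 Thm 2; exact closed
form constant `1.22404`; `= 0.248` at `T → 0` against `0.447` from the degree bound). kind: support
(PROVED modulo the named fact). -/
@[conjecture] def ThermalMottCDWCeilingU20KK : Prop :=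
  kuboKishi_charge_gaussianDomination →
  ∀ (L : ℕ) [NeZero L], Even L → 3 ≤ L → ∀ β : ℝ, 0 < β →
    (gibbsState β (hamiltonianWith (fermionTorusGraph 2 L) 1 20 (20 / 2))
        (chargeDensityField (fun x => ((torusStagger (d := 2) (L := L) x : ℤ) : ℝ)) *
          chargeDensityField fun x => ((torusStagger (d := 2) (L := L) x : ℤ) : ℝ))).re ≤
      (L : ℝ) ^ 2 * (1 / (20 * β) + Real.sqrt ((1.228 + Real.log 4 / β) / 20))

omit [NeZero L] in
/-- **`ThermalMottCDWCeilingU20KK` holds.** -/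
theorem thermalMottCDWCeilingU20KK_holds : ThermalMottCDWCeilingU20KK := by
  intro hKK L _ hLe hL β hβ
  have h := re_gibbsState_staggeredCharge_sq_le_mott_gc hKK hLe hL (U := 20) (U₁ := 10) (Δ := 10)
    (by norm_num) (by norm_num) (by norm_num) hβ
  have hA : (0.37138 : ℝ) ≤ 4 / Real.sqrt (16 + 10 ^ 2) :=
    four_div_sqrt_ge' (by norm_num) (Real.sqrt_le_iff.2 ⟨by norm_num, by norm_num⟩ :
      Real.sqrt (16 + 10 ^ 2) ≤ 10.7704) (by norm_num) (by norm_num)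
  have hB : Real.sqrt (4 + (10 / 4) ^ 2) ≤ 3.2016 := Real.sqrt_le_iff.2 ⟨by norm_num, by norm_num⟩
  have hX := mott_sharp_numeric_20 hA hB
  -- `X := (10 sdwClosed 20 10 - 20 lmClosed 10)/10 ≤ 4 · 0.307 = 1.228`
  set X : ℝ := (10 * sdwClosed 20 10 - 20 * lmClosed 10) / (20 - 10) with hXdef
  have hX' : X ≤ 1.228 := by
    have : X / 4 ≤ 0.307 := by
      rw [hXdef, sdwClosed, lmClosed]
      exact hX
    linarith
  have hL2 : (0 : ℝ) < (L : ℝ) ^ 2 := by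
    have : (0 : ℝ) < L := by exact_mod_cast (show 0 < L by omega)
    positivity
  have hℓ0 : 0 ≤ Real.log 4 / β := div_nonneg (Real.log_nonneg (by norm_num)) hβ.le
  -- rewrite the right side of `h`
  have e1 : (L : ℝ) ^ 2 / 20 *
      (4 * ((L : ℝ) ^ 2 * X + 10 / (20 - 10) * ((L : ℝ) ^ 2 * Real.log 4 / β))) =
      (2 * (L : ℝ) ^ 2) ^ 2 * ((X + Real.log 4 / β) / 20) := by
    ring
  have hsqrt : Real.sqrt ((L : ℝ) ^ 2 / 20 *
      (4 * ((L : ℝ) ^ 2 * X + 10 / (20 - 10) * ((L : ℝ) ^ 2 * Real.log 4 / β)))) ≤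
      2 * (L : ℝ) ^ 2 * Real.sqrt ((1.228 + Real.log 4 / β) / 20) := by
    rw [e1, Real.sqrt_mul (sq_nonneg _), Real.sqrt_sq (by positivity)]
    refine mul_le_mul_of_nonneg_left (Real.sqrt_le_sqrt ?_) (by positivity)
    gcongr
  have e2 : (L : ℝ) ^ 2 * (1 / (20 * β) + Real.sqrt ((1.228 + Real.log 4 / β) / 20)) =
      (L : ℝ) ^ 2 / 20 / β + 1 / 2 * (2 * (L : ℝ) ^ 2 * Real.sqrt ((1.228 + Real.log 4 / β) / 20)) := by
    ring
  rw [e2]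
  linarith

end Torus

end Summit.HubbardSuperconductivity.HubbardLadder.Bounds

end
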